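import Literature.AlgebraicTopology.KTheory.BottIndex5
import HarnessLib

/-!
# Bott periodicity: `K⁰(X) ⊕ K⁰(X) ≅ K⁰(X × S²)` (Husemöller, *Fibre Bundles*, Ch. 11 Thm. 5.4)

For a compact Hausdorff space `X`:

* `indIdem P` — the index of any clutching description of an idempotent `P` over `X × S²`
  (well defined by `BottIndex5`), additive and invariant under equivalence, whence the
  homomorphism **`ind : K⁰(X × S²) →+ K⁰(X)`** (Husemöller's `ν₂`) with `ind_of`, `ind_bottClass`;
* the computations `ind_pullback_prX : ind(pr₁^*α) = 0` and
  `ind_pullback_prX_mul_bottγ : ind(pr₁^*β · γ) = β` (`γ = [θ¹, z]`);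
* `bott_injective : pr₁^*α + pr₁^*β·γ = 0 → α = 0 ∧ β = 0`, and with `bott_surjective`
  (`BottSurj.lean`) the group isomorphism
  **`bottPeriodicity X : K⁰(X) × K⁰(X) ≃+ K⁰(X × S²)`, `(α, β) ↦ pr₁^*α + pr₁^*β·γ`**,
  `ind_bottPeriodicity : ind (Φ(α, β)) = β`.

Everything is proved; no named facts.

## References

* D. Husemöller, *Fibre Bundles*, 3rd ed. (1994) [HusemollerFibreBundles1994]: Ch. 11 Thm. 5.4,
  Cor. 5.5 (Bott periodicity `K(X × S²) ≅ K(X) ⊗ K(S²)`).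
-/

noncomputable section

open Set Metric unitInterval Complex

namespace Literature.AlgebraicTopology.KTheory

open Literature.RingTheory.KTheory Matrix Pencil Linearization

universe u

variable {X : Type u} [TopologicalSpace X] [CompactSpace X] [T2Space X]

/-! ### The index of an idempotent over `X × S²` -/

/-- **`ind(P) ∈ K⁰(X)`**: the index of the extended clutching function of `P` w.r.t. its slice
`s^*P` (by model and witness independence, any clutching description of `P` computes it). [cite: HusemollerFibreBundles1994, Ch. 11 Thm. 5.4] -/
def indIdem (P : Idem C(X × S2r, ℂ)) : K0 X := indGL (Classical.choose (exists_isClutched_of_idem P)).ext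

/-- **`ind(P) = ind(ũ)` for any clutching description `P ≅ [ζ, u]`.** [cite: HusemollerFibreBundles1994, Ch. 11 Thm. 5.4] -/
theorem indIdem_eq {P : Idem C(X × S2r, ℂ)} {ζ : Idem C(X, ℂ)} {c : ClutchingFn ζ} (h : IsClutched P.mat ζ c) : indIdem P = indGL c.ext :=
  indGL_ext_eq_of_isClutched' h (Classical.choose_spec (exists_isClutched_of_idem P))

/-- `ind` of a matrix clutched from `(ζ, u)`, via `Idem.ofMatrix`. [folklore] -/
theorem indIdem_ofMatrix {m : Type*} [Fintype m] {Q : Matrix m m C(X × S2r, ℂ)} {ζ : Idem C(X, ℂ)} {c : ClutchingFn ζ} (h : IsClutched Q ζ c) :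
    indIdem (Idem.ofMatrix Q h.isIdempotentElem) = indGL c.ext :=
  indIdem_eq (h.reindex _)

omit [CompactSpace X] [T2Space X] in
/-- `ũ ⊕ ũ' = (u ⊕ u')~`. [folklore] -/
theorem ClutchingFn.ext_sum {ζ ζ' : Idem C(X, ℂ)} (c : ClutchingFn ζ) (c' : ClutchingFn ζ') : (c.sum c').ext = glSum c.ext c'.ext := by
  have hp : pullA (ζ + ζ') = glSum (pullA ζ) (pullA ζ') := pullA_add ζ ζ'
  unfold ClutchingFn.ext
  dsimp only [Idem.add_size] at hp ⊢
  rw [hp, ← glSum_add, ← glSum_sub, glSum_one]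
  rfl

/-- **Additivity**: `ind(P ⊕ Q) = ind(P) + ind(Q)`. [cite: HusemollerFibreBundles1994, Ch. 11 Thm. 5.4] -/
theorem indIdem_add (P Q : Idem C(X × S2r, ℂ)) : indIdem (P + Q) = indIdem P + indIdem Q := by
  obtain ⟨c, hc⟩ := exists_isClutched_of_idem P
  obtain ⟨c', hc'⟩ := exists_isClutched_of_idem Q
  have hs : IsClutched (P + Q).mat _ (c.sum c') := (hc.sum hc').reindex finSumFinEquiv
  rw [indIdem_eq hs, indIdem_eq hc, indIdem_eq hc', ClutchingFn.ext_sum]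
  exact indGL_glSum c.isUnit_ext c'.isUnit_ext

/-- **Invariance under equivalence**: `P ∼ Q ⇒ ind(P) = ind(Q)`. [cite: HusemollerFibreBundles1994, Ch. 11 Thm. 5.4] -/
theorem indIdem_congr {P Q : Idem C(X × S2r, ℂ)} (h : AlgEquivalent P.mat Q.mat) : indIdem P = indIdem Q := by
  obtain ⟨c, w, hw⟩ := exists_isClutched_of_idem P
  obtain ⟨x, y, hxy, hyx, hx, hy⟩ := h
  have hQ : IsClutched Q.mat _ c := ⟨w.ofAlgEquivalent y x hyx hxy hy, (w.g_ofAlgEquivalent y x hyx hxy hy).trans hw⟩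
  rw [indIdem_eq ⟨w, hw⟩, indIdem_eq hQ]

/-- `ind(0) = 0`. [folklore] -/
theorem indIdem_zero : indIdem (0 : Idem C(X × S2r, ℂ)) = 0 := by
  have h := indIdem_add (0 : Idem C(X × S2r, ℂ)) 0
  rw [indIdem_congr (Idem.equiv_iff.1 (Idem.zero_add_equiv (0 : Idem C(X × S2r, ℂ))))] at h
  exact left_eq_add.1 h

/-- `ind` on equivalence classes of idempotents. [folklore] -/
def indClassHom : IdemClass C(X × S2r, ℂ) →+ K0 X where
  toFun := Quotient.lift indIdem fun _ _ h ↦ indIdem_congr h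
  map_zero' := indIdem_zero
  map_add' := by
    refine Quotient.ind₂ fun P Q ↦ ?_
    exact indIdem_add P Q

/-- **The index homomorphism `ind : K⁰(X × S²) → K⁰(X)`** (Husemöller's `ν₂`). [cite: HusemollerFibreBundles1994, Ch. 11 Thm. 5.4] -/
def ind : K0 (X × S2r) →+ K0 X := Algebra.GrothendieckAddGroup.lift indClassHom

/-- `ind [P] = ind(P)`. [cite: HusemollerFibreBundles1994, Ch. 11 Thm. 5.4] -/
theorem ind_of (P : Idem C(X × S2r, ℂ)) : ind (KZero.of P) = indIdem P := KZero.lift_of _ _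

/-- `ind [ζ, u] = ind(ũ)`. [cite: HusemollerFibreBundles1994, Ch. 11 Thm. 5.4] -/
theorem ind_bottClass {ζ : Idem C(X, ℂ)} (c : ClutchingFn ζ) : ind (bottClass ζ c) = indGL c.ext := by
  rw [bottClass, ind_of, indIdem_ofMatrix (Classical.choose_spec (exists_isClutched ζ c))]

/-! ### The two computations: `ind(pr₁^*α) = 0` and `ind(pr₁^*β · γ) = β` -/

omit [CompactSpace X] [T2Space X] in
/-- Auxiliary statement for the index map of Bott periodicity. [folklore] -/
theorem ClutchingFn.ext_one (ζ : Idem C(X, ℂ)) : (ClutchingFn.one ζ).ext = 1 := by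
  rw [ClutchingFn.ext]; change pullA ζ + (1 - pullA ζ) = 1; abel

/-- **`ind(pr₁^*[ζ]) = 0`.** [cite: HusemollerFibreBundles1994, Ch. 11 Thm. 5.4] -/
theorem ind_pullback_prX_of (ζ : Idem C(X, ℂ)) : ind (pullback (prX X) (KZero.of ζ)) = 0 := by
  rw [pullback_of, ind_of, indIdem_eq (P := ζ.map (comapRingHom (prX X))) (isClutched_map_prX ζ), ClutchingFn.ext_one, indGL_one]

/-- **`ind ∘ pr₁^* = 0`.** [cite: HusemollerFibreBundles1994, Ch. 11 Thm. 5.4] -/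
theorem ind_pullback_prX (α : K0 X) : ind (pullback (prX X) α) = 0 := by
  obtain ⟨p, q, rfl⟩ := KZero.exists_of_sub_of α
  rw [map_sub, map_sub, ind_pullback_prX_of, ind_pullback_prX_of, sub_zero]

omit [T2Space X] in
/-- Auxiliary statement for the index map of Bott periodicity. [folklore] -/
theorem ClutchingFn.ext_zClutch (ζ : Idem C(X, ℂ)) : (zClutch ζ).ext = linClutch ζ.mat (1 - ζ.mat) := by
  rw [ClutchingFn.ext, linClutch, liftA, liftA, Matrix.map_sub _ (map_sub _), Matrix.map_one _ (map_zero _) (map_one _)]; rfl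

/-- **`ind(pr₁^*[ζ] · γ) = [ζ]`** (`L(ζ, z)₊ = ζ`). [cite: HusemollerFibreBundles1994, Ch. 11 Thm. 5.4] -/
theorem ind_pullback_prX_of_mul_bottγ (ζ : Idem C(X, ℂ)) : ind (pullback (prX X) (KZero.of ζ) * bottγ X) = KZero.of ζ := by
  rw [← bottClass_zClutch, ind_bottClass, ClutchingFn.ext_zClutch, indGL_sp ζ.isIdempotentElem]

/-- **`ind(pr₁^*β · γ) = β`.** [cite: HusemollerFibreBundles1994, Ch. 11 Thm. 5.4] -/
theorem ind_pullback_prX_mul_bottγ (β : K0 X) : ind (pullback (prX X) β * bottγ X) = β := by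
  obtain ⟨p, q, rfl⟩ := KZero.exists_of_sub_of β
  rw [map_sub, sub_mul, map_sub, ind_pullback_prX_of_mul_bottγ, ind_pullback_prX_of_mul_bottγ]

/-! ### Bott periodicity -/

omit [CompactSpace X] [T2Space X] in
/-- `s^* pr₁^* = id`. [folklore] -/
theorem pullback_sX_pullback_prX (α : K0 X) : pullback sX (pullback (prX X) α) = α := by
  have h : (prX X).comp sX = ContinuousMap.id X := by ext x; rfl
  rw [← AddMonoidHom.comp_apply, ← pullback_comp, h, pullback_id]; rfl

variable (X) in
/-- **The Bott map** `Φ(α, β) = pr₁^*α + pr₁^*β · γ : K⁰(X) ⊕ K⁰(X) → K⁰(X × S²)`. [cite: HusemollerFibreBundles1994, Ch. 11 Thm. 5.4] -/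
def bottMap : K0 X × K0 X →+ K0 (X × S2r) :=
  AddMonoidHom.coprod (pullback (prX X)) ((AddMonoidHom.mulRight (bottγ X)).comp (pullback (prX X)))

/-- Auxiliary statement for the index map of Bott periodicity. [folklore] -/
@[simp] theorem bottMap_apply (α β : K0 X) : bottMap X (α, β) = pullback (prX X) α + pullback (prX X) β * bottγ X := rfl

/-- **Injectivity of the Bott map**: `pr₁^*α + pr₁^*β·γ = 0 ⇒ α = 0 ∧ β = 0` (apply `ind`, then `s^*`). [cite: HusemollerFibreBundles1994, Ch. 11 Thm. 5.4] -/
theorem bott_injective {α β : K0 X} (h : pullback (prX X) α + pullback (prX X) β * bottγ X = 0) : α = 0 ∧ β = 0 := by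
  have hβ : β = 0 := by
    have := congrArg ind h
    rwa [map_add, ind_pullback_prX, ind_pullback_prX_mul_bottγ, zero_add, map_zero] at this
  subst hβ
  rw [map_zero, zero_mul, add_zero] at h
  have := congrArg (pullback sX) h
  rw [pullback_sX_pullback_prX, map_zero] at this
  exact ⟨this, rfl⟩

/-- Auxiliary statement for the index map of Bott periodicity. [folklore] -/
theorem bottMap_injective : Function.Injective (bottMap X) := by
  refine (injective_iff_map_eq_zero _).2 ?_
  rintro ⟨α, β⟩ h
  obtain ⟨rfl, rfl⟩ := bott_injective h
  rfl

/-- Auxiliary statement for the index map of Bott periodicity. [folklore] -/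
theorem bottMap_surjective : Function.Surjective (bottMap X) := fun ξ ↦ by
  obtain ⟨α, β, rfl⟩ := bott_surjective ξ
  exact ⟨(α, β), rfl⟩

variable (X) in
/-- **Bott periodicity (Husemöller, *Fibre Bundles*, Ch. 11 Thm. 5.4 / Cor. 5.5)**: for a compact
Hausdorff space `X`, the Bott map `(α, β) ↦ pr₁^*α + pr₁^*β · γ` is an isomorphism of groups
`K⁰(X) ⊕ K⁰(X) ≅ K⁰(X × S²)`; equivalently `K⁰(X × S²)` is the free `K⁰(X)`-module on `1, γ`
(with `(γ - 1)² = 0`). [cite: HusemollerFibreBundles1994, Ch. 11 Thm. 5.4] -/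
def bottPeriodicity : (K0 X × K0 X) ≃+ K0 (X × S2r) :=
  AddEquiv.ofBijective (bottMap X) ⟨bottMap_injective, bottMap_surjective⟩

/-- Auxiliary statement for the index map of Bott periodicity. [folklore] -/
@[simp] theorem bottPeriodicity_apply (α β : K0 X) : bottPeriodicity X (α, β) = pullback (prX X) α + pullback (prX X) β * bottγ X := rfl

/-- The inverse of Bott periodicity is `ξ ↦ (s^*ξ - ind ξ·?, ind ξ)`: concretely the second
component is the index `ind`. [cite: HusemollerFibreBundles1994, Ch. 11 Thm. 5.4] -/
theorem ind_bottPeriodicity (α β : K0 X) : ind (bottPeriodicity X (α, β)) = β := by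
  rw [bottPeriodicity_apply, map_add, ind_pullback_prX, ind_pullback_prX_mul_bottγ, zero_add]

end Literature.AlgebraicTopology.KTheory

end
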